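import Summits.CriticalPhenomena.PercolationContinuityZ3.Theorems.PercNearOneGluingNoHeavyQuantGluedTwoColDual
import Summits.CriticalPhenomena.PercolationContinuityZ3.Theorems.PercNearOneGluingNoHeavyQuantGluedWindowLight
import HarnessLib

/-!
# QUANT lane R8, T-DEC: LEMMA W's pair condition in the two-row regime — FIRST h-MID CELL: the two lower copies of the low atom pair neither with its top
# copy nor with the high atom; the giant copy of the high atom absorbs them, NO cheapness (arm-1 gen 59, architect)

builds on p205010 (kernel theorem, internal audit signed; external expert review pending)

Support file (`--supports stmt-CriticalPhenomena-4575`), QUANT lane seat prim-quant-arm-1 (gen 59); memo `run/shared/lean/prim/quant/prim-quant-arm-1-g59/ARCH-G59.md`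
§7.  Theorems only; standard axioms, no sorries, no definitions.  Companion of `…QuantGluedWindowFarLight` / `…NearLight` (the h-LOW cells) on the h-MID side
of the two-row regime (`2(l+r) < T ≤ 2(l+r+k)`, `T ≤ 2h`): when the middle copy `l+r` of the low atom is incompatible with the high atom (`l+r+h ≤ T`)
and the bottom copy with the top copy (`2l+r+k ≤ T`), the cell forces `ρ₀ > 1 − y` (from `d(1−ρ₀) < ky` and `k(1−y) < ρ₀d`, band2), hence
`γ = y² + (1−y)ρ₀ > 2(y−½)² + ½ ≥ ½`, hence `γt₂ ≥ (1−γ)(t₀+t₁)u`: the giant copy `h+r+k` of the high atom alone absorbs the two low rows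
(**`gluedPullback_windowPair_twoRow_poolOnly`**; survey kit j297905: the patterns `L0L2−, L1h−` of `LLM|MGG`, `LLM|MMG` — ≈ 0.65 M of 6.5 M pairs — thus
need no mid column and no cheap atom, whatever the status of the pairs `(l+r, l+r+k)`, `(l, h+r)`, `(l+r, h+r)`).

HONEST STATUS.  `GluedLemmaW` (flow form), `GluedDominatedMass`, the band, `SiblingStep`, `FarTreeRow` OPEN; RATE class (log\*) / honest sentence of
`run/shared/lean/prim/quant/README.md` unchanged.  [this work].  Nothing here is cited as a published result.  The gluing rows served
[cite: KozmaNitzan2024, Conjecture 3 (p. 15)]; product measure [cite: Grimmett1999, §1.3 p. 10].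
-/

set_option maxHeartbeats 1600000

noncomputable section

open scoped BigOperators

namespace Summit.CriticalPhenomena.PercolationContinuityZ3.Theorems
namespace Quant

open Finset

namespace LawDec

/-- **TWO-ROW REGIME, CELL "pool only" (h a mid)**: `l+r+k ≤ j` a mid for the glued target (`T ≤ 2(l+r+k)`), `h` a mid (`T ≤ 2h`), the middle copy
`l+r` low (`2(l+r) < T`) and incompatible with `h` (`l+r+h ≤ T`), the bottom copy `l` incompatible with `l+r+k` (`2l+r+k ≤ T`).  Then for EVERY price
system `(α, p)` at `(y, T, j)`: `(1−γ)Ψ(l) + γΨ(h) ≤ 0` — the giant `h+r+k` absorbs `l` and `l+r`; no cheap atom, no mid column. [this work] -/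
theorem gluedPullback_windowPair_twoRow_poolOnly (x a q g S : ℝ) (B r k j l h : ℕ) (α p : ℕ → ℝ)
    (hx0 : 0 < x) (hx1 : x < 1) (ha0 : 0 < a) (ha1 : a ≤ 1) (hq0 : 0 < q) (hq1 : q < 1) (hg1 : g ≤ 1) (hk : 1 ≤ k)
    (hxqg : x ≤ q * g) (hband2 : q * ((r : ℝ) + k * g) - r < (k : ℝ) * x)
    (hlh : l < h) (hhB : h ≤ B) (hhj : h ≤ j) (hwin : j < h + r + k) (hlow : 2 * (l : ℝ) < a * S) (hcomp : a * S < (l : ℝ) + h)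
    (hlight : pairGate (a * x) (a * S) l h < a * x)
    (hL2j : l + r + k ≤ j) (hL2mid : a * (S + q * ((r : ℝ) + k * g)) ≤ 2 * ((l : ℝ) + r + k))
    (hL1low : 2 * ((l : ℝ) + r) < a * (S + q * ((r : ℝ) + k * g)))
    (hincl : 2 * (l : ℝ) + r + k ≤ a * (S + q * ((r : ℝ) + k * g))) (hinch : (l : ℝ) + r + h ≤ a * (S + q * ((r : ℝ) + k * g)))
    (hhmid : a * (S + q * ((r : ℝ) + k * g)) ≤ 2 * (h : ℝ))
    (hp : ∀ h, 0 ≤ p h)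
    (hαp : ∀ l' h', l' ≤ j → 2 * (l' : ℝ) < a * (S + q * ((r : ℝ) + k * g)) → h' ≤ B + (r + k) →
      (j + 1 ≤ h' ∨ a * (S + q * ((r : ℝ) + k * g)) < (l' : ℝ) + h') →
      α l' ≤ usage (a * x) (a * (S + q * ((r : ℝ) + k * g))) j l' h' * p h') :
    (1 - pairGate (a * x) (a * S) l h) * gluedPullback (a * (S + q * ((r : ℝ) + k * g))) q g j r k α p l
      + pairGate (a * x) (a * S) l h * gluedPullback (a * (S + q * ((r : ℝ) + k * g))) q g j r k α p h ≤ 0 := by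
  set y : ℝ := a * x with hy
  set T : ℝ := a * (S + q * ((r : ℝ) + k * g)) with hT
  set T₀ : ℝ := a * S with hT₀
  set t0 : ℝ := 1 - q with ht0
  set t1 : ℝ := q * (1 - g) with ht1
  set t2 : ℝ := q * g with ht2
  clear_value y T T₀ t0 t1 t2
  have hy0 : 0 < y := by rw [hy]; exact mul_pos ha0 hx0
  have hyx : y ≤ x := by rw [hy]; nlinarith
  have hy1 : y < 1 := by linarith
  have h1y : 0 < 1 - y := by linarith
  have hu0 : 0 ≤ y / (1 - y) := div_nonneg hy0.le h1y.le
  have hyt2 : y ≤ t2 := by rw [ht2]; linarith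
  have ht0p : 0 ≤ t0 := by rw [ht0]; linarith
  have ht1p : 0 ≤ t1 := by rw [ht1]; exact mul_nonneg hq0.le (by linarith)
  have ht2p : 0 ≤ t2 := by linarith
  have hts : t0 + t1 + t2 = 1 := by rw [ht0, ht1, ht2]; ring
  have hr0 : (0:ℝ) ≤ r := Nat.cast_nonneg r
  have hk1 : (1:ℝ) ≤ k := by exact_mod_cast hk
  have hkpos : (0:ℝ) < k := by linarith
  -- T − T₀ = A = a(q r + t2 k) < k y + a r (band2)
  have hA : T - T₀ = a * (q * (r : ℝ) + t2 * k) := by rw [hT, hT₀, ht2]; ring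
  have hband2a : a * (q * (r : ℝ) + t2 * k) < (k : ℝ) * y + a * r := by
    have e1 : q * ((r : ℝ) + k * g) - r = q * r + t2 * k - r := by rw [ht2]; ring
    rw [e1] at hband2
    have := mul_lt_mul_of_pos_left hband2 ha0
    have e2 : a * ((k : ℝ) * x) = (k : ℝ) * y := by rw [hy]; ring
    have e3 : a * (q * (r : ℝ) + t2 * k - r) = a * (q * (r : ℝ) + t2 * k) - a * r := by ring
    linarith [this, e2, e3]
  have har : a * (r : ℝ) ≤ r := mul_le_of_le_one_left hr0 ha1
  have hlh' : (l : ℝ) < h := by exact_mod_cast hlh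
  have hd0 : (0:ℝ) < (h : ℝ) - l := by linarith
  -- the light gate γ = y² + (1−y)ρ₀ and the cell's lower bound ρ₀ > 1 − y
  obtain ⟨ρ₀, hρ₀⟩ : ∃ ρ₀ : ℝ, ρ₀ = (T₀ - 2 * (l : ℝ)) / ((h : ℝ) - l) := ⟨_, rfl⟩
  have hρ₀y : ρ₀ < y := by
    have : (T₀ - 2 * (l : ℝ)) / ((h : ℝ) - l) ≤ pairGate y T₀ l h := le_max_left _ _
    rw [hρ₀]; linarith
  have hρ₀0 : 0 < ρ₀ := by rw [hρ₀]; exact div_pos (by linarith) hd0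
  have hρ₀1 : 0 ≤ 1 - ρ₀ := by linarith
  have hγ : pairGate y T₀ l h = y ^ 2 + (1 - y) * ρ₀ := by
    rw [hρ₀]; exact pairGate_eq_light y T₀ l h hy0.le (by rw [← hρ₀]; exact hρ₀y.le)
  have eT₀ : T₀ - 2 * (l : ℝ) = ρ₀ * ((h : ℝ) - l) := by rw [hρ₀]; field_simp
  obtain ⟨d, hd⟩ : ∃ d : ℝ, d = (h : ℝ) - l := ⟨_, rfl⟩
  rw [← hd] at eT₀
  have hdpos : 0 < d := by rw [hd]; exact hd0
  -- (i') l + r + h ≤ T ⟹ d(1−ρ₀) + r ≤ A < ky + ar ⟹ d(1−ρ₀) < ky ;  (iii) 2l+r+k ≤ T ⟹ r + k ≤ ρ₀d + A ⟹ k(1−y) < ρ₀ d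
  have hi : d * (1 - ρ₀) < (k : ℝ) * y := by
    have h1 : (h : ℝ) - l + r ≤ ρ₀ * d + a * (q * (r : ℝ) + t2 * k) := by linarith [hA, eT₀, hinch]
    rw [← hd] at h1
    have e : d * (1 - ρ₀) = d - ρ₀ * d := by ring
    linarith [h1, hband2a, har, e]
  have hiii : (k : ℝ) * (1 - y) < ρ₀ * d := by
    have h1 : (r : ℝ) + k ≤ ρ₀ * d + a * (q * (r : ℝ) + t2 * k) := by linarith [hA, eT₀, hincl]
    have e : (k : ℝ) * (1 - y) = k - (k : ℝ) * y := by ring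
    linarith [h1, hband2a, har, e]
  have hρ₀low : 1 - y < ρ₀ := by
    have s1 : (k : ℝ) * (1 - y) * (1 - ρ₀) ≤ ρ₀ * d * (1 - ρ₀) := mul_le_mul_of_nonneg_right hiii.le hρ₀1
    have s2 : ρ₀ * (d * (1 - ρ₀)) < ρ₀ * ((k : ℝ) * y) := mul_lt_mul_of_pos_left hi hρ₀0
    have e1 : ρ₀ * d * (1 - ρ₀) = ρ₀ * (d * (1 - ρ₀)) := by ring
    have key : (k : ℝ) * ((1 - y) * (1 - ρ₀)) < (k : ℝ) * (ρ₀ * y) := by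
      have e2 : (k : ℝ) * ((1 - y) * (1 - ρ₀)) = (k : ℝ) * (1 - y) * (1 - ρ₀) := by ring
      have e3 : (k : ℝ) * (ρ₀ * y) = ρ₀ * ((k : ℝ) * y) := by ring
      linarith [s1, s2, e1, e2, e3]
    have := lt_of_mul_lt_mul_left key hkpos.le
    nlinarith [this]
  have hγhalf : 1 / 2 ≤ y ^ 2 + (1 - y) * ρ₀ := by
    nlinarith [mul_le_mul_of_nonneg_left hρ₀low.le h1y.le, sq_nonneg (y - 1 / 2)]
  obtain ⟨γ, hγdef⟩ : ∃ γ : ℝ, γ = y ^ 2 + (1 - y) * ρ₀ := ⟨_, rfl⟩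
  have hγ' : pairGate y T₀ l h = γ := by rw [hγ, hγdef]
  have hγ0 : 0 ≤ γ := by rw [hγdef]; linarith
  have hγ1 : γ ≤ 1 := by rw [hγdef]; nlinarith [mul_le_mul_of_nonneg_left hρ₀y.le h1y.le]
  have h1γ : 0 ≤ 1 - γ := by linarith
  have h2γ : 0 ≤ 2 * γ - 1 := by rw [hγdef]; linarith
  -- E = γ t2 − (1−γ)(t0+t1) u ≥ 0
  have et01 : t0 + t1 = 1 - t2 := by linarith
  have hE0 : (1 - γ) * (t0 + t1) * (y / (1 - y)) ≤ γ * t2 := by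
    rw [et01, ← mul_div_assoc, div_le_iff₀ h1y]
    have a1 : γ * y * (1 - y) ≤ γ * t2 * (1 - y) := mul_le_mul_of_nonneg_right (mul_le_mul_of_nonneg_left hyt2 hγ0) h1y.le
    have a2 : (1 - γ) * (1 - t2) * y ≤ (1 - γ) * (1 - y) * y :=
      mul_le_mul_of_nonneg_right (mul_le_mul_of_nonneg_left (by linarith : 1 - t2 ≤ 1 - y) h1γ) hy0.le
    have a3 : 0 ≤ y * (1 - y) * (2 * γ - 1) := mul_nonneg (mul_nonneg hy0.le h1y.le) h2γ
    have e3 : γ * t2 * (1 - y) - (1 - γ) * (1 - t2) * y - y * (1 - y) * (2 * γ - 1)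
        = (γ * t2 * (1 - y) - γ * y * (1 - y)) + ((1 - γ) * (1 - y) * y - (1 - γ) * (1 - t2) * y) := by ring
    linarith [a1, a2, a3, e3]
  -- low / non-low statuses
  have hL0 : l ≤ j ∧ 2 * (l : ℝ) < T := ⟨by omega, by linarith⟩
  have hL1 : l + r ≤ j ∧ 2 * ((l + r : ℕ) : ℝ) < T := ⟨by omega, by push_cast; linarith only [hL1low]⟩
  have hL2n : ¬ (l + r + k ≤ j ∧ 2 * ((l + r + k : ℕ) : ℝ) < T) := by push_cast; intro hh; linarith [hh.2]
  have hHn : ∀ v : ℕ, h ≤ v → ¬ (v ≤ j ∧ 2 * (v : ℝ) < T) := by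
    intro v hv hh
    have : (h : ℝ) ≤ v := by exact_mod_cast hv
    linarith [hh.2]
  have cL : ∀ v : ℕ, (v ≤ j ∧ 2 * (v : ℝ) < T) → coefAt T j α p v = α v := fun v hv => by simp only [coefAt, if_pos hv]
  have cN : ∀ v : ℕ, ¬ (v ≤ j ∧ 2 * (v : ℝ) < T) → coefAt T j α p v = -p v := fun v hv => by simp only [coefAt, if_neg hv]
  have eΨl : gluedPullback T q g j r k α p l = t0 * α l + t1 * α (l + r) - t2 * p (l + r + k) := by
    simp only [gluedPullback, cL l hL0, cL (l + r) hL1, cN (l + r + k) hL2n, ht0, ht1, ht2]; ring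
  have eΨh : gluedPullback T q g j r k α p h = -(t0 * p h + t1 * p (h + r) + t2 * p (h + r + k)) := by
    simp only [gluedPullback, cN h (hHn h le_rfl), cN (h + r) (hHn (h + r) (by omega)), cN (h + r + k) (hHn (h + r + k) (by omega)),
      ht0, ht1, ht2]; ring
  -- the giant h + r + k absorbs l and l + r
  set P : ℝ := p (h + r + k) with hP
  have hP0 : 0 ≤ P := hp _
  have hH2M : h + r + k ≤ B + (r + k) := by omega
  have giant : ∀ w : ℕ, w ≤ j → 2 * (w : ℝ) < T → α w ≤ y / (1 - y) * P := by
    intro w hwj hwl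
    have := hαp w (h + r + k) hwj hwl hH2M (Or.inl (by omega))
    rwa [usage_giant_eq y T j w (h + r + k) (by omega)] at this
  have bl := giant l hL0.1 hL0.2
  have bL1 := giant (l + r) hL1.1 hL1.2
  have low2 : (1 - γ) * (t0 * α l + t1 * α (l + r)) ≤ (1 - γ) * (t0 + t1) * (y / (1 - y)) * P := by
    have h1 := add_le_add (mul_le_mul_of_nonneg_left bl ht0p) (mul_le_mul_of_nonneg_left bL1 ht1p)
    have h2 := mul_le_mul_of_nonneg_left h1 h1γ
    have e : (1 - γ) * (t0 * (y / (1 - y) * P) + t1 * (y / (1 - y) * P)) = (1 - γ) * (t0 + t1) * (y / (1 - y)) * P := by ring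
    linarith only [h2, e]
  have hEP := mul_le_mul_of_nonneg_right hE0 hP0
  have n1 : 0 ≤ (1 - γ) * t2 * p (l + r + k) := mul_nonneg (mul_nonneg h1γ ht2p) (hp _)
  have n2 : 0 ≤ γ * (t0 * p h + t1 * p (h + r)) := mul_nonneg hγ0 (add_nonneg (mul_nonneg ht0p (hp _)) (mul_nonneg ht1p (hp _)))
  rw [hγ', eΨl, eΨh]
  have eL : (1 - γ) * (t0 * α l + t1 * α (l + r) - t2 * p (l + r + k)) + γ * -(t0 * p h + t1 * p (h + r) + t2 * P)
      = (1 - γ) * (t0 * α l + t1 * α (l + r)) - (1 - γ) * t2 * p (l + r + k) - γ * (t0 * p h + t1 * p (h + r)) - γ * t2 * P := by ring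
  linarith only [low2, hEP, n1, n2, eL]

end LawDec
end Quant
end Summit.CriticalPhenomena.PercolationContinuityZ3.Theorems
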